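/-
Copyright (c) 2026. All rights reserved.
Released under Apache 2.0 license as described in the file LICENSE.
Authors: abc-iut cell, prover seat abc-iut-f-101 (gen 5; row «SB′-D2», abc-iut-L4-lead m136), over the statement of
abc-iut-w5-d144 (`LogFrobeniusMonoTelecoreObservables`, p484312) and its embedding lemmas (`…Emb`, `…EmbTS`), the generic
toolkits `DiagramSinkSystems` / `DiagramPathEmbeddings` (this seat), `DiagramChainFamiliesTwoSided` (abc-iut-w5-d144),
`DiagramOverHomotopies` (abc-iut-w6-d025), abc-iut-L4-t5's universal families, abc-iut-w5-d053's `pushFamily`, and this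
seat's gen-2 telecore `monoTelecore` — nothing of those files is re-meant.
-/
import Literature.AnabelianGeometry.AbsoluteAnabelian.LogFrobeniusMonoTelecoreObservablesSinks
import Literature.AnabelianGeometry.AbsoluteAnabelian.DiagramSinkSystems
import HarnessLib

/-!
# [AbsTopIII] Cor 5.10 (iv)(b), last sentence — SUFFICIENCY: `𝔗_{An⊢}` and the observables `S_log⊞`, `S_log` are compatible

S. Mochizuki, *Topics in absolute anabelian geometry III: global reconstruction algorithms*,
J. Math. Sci. Univ. Tokyo 22 (2015) 939–1156 [MochizukiAbsTopIII2015]; locators `p.N` = pages of the author's manuscript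
(`paper:url-5493eb38cbb7`), read on the page: Cor 5.10 (iv)(b) pp. 147–148 ("… give rise to a telecore structure `𝔗_{An⊢}` on
`D•⊢_{≤5} ∪ D•_{≤6}` … Moreover, the respective family of homotopies of `𝔗_{An⊢}` and the observables `S_log`, `S_log⊞` of
Corollary 5.5, (iii), are compatible"), Def 3.5 (ii) p. 75 ("compatible": contained in ONE family with the same homotopies),
Rmk 3.5.1 p. 78 (a core as "a sort of 'constant portion' of the diagram that lies, in a consistent fashion, 'under the entire
diagram'").

PROOF-SIDE companion (part 3 of 3) of abc-iut-w5-d144's `Cor510MonoTelecoreObservablesCompatible` (`s_b′`, p484312; nothing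
there is restated).  **Abstract sufficiency** (spec `COR510iv-SBprime-CLOSER-SPEC.md` §6, brick D2): for a setting `L` with
`V(F_mod) ≠ ∅`, the rows-4→5 mono-analyticization homotopies `hN` and "`ψ^{An⊢⊞}` over `ℰ⊢`" `hψ` (the data of this seat's
`monoTelecore`, Cor 5.10 (iv)(b) first sentence), observable families `Hplus v` (`S_log⊞_v`) and `Hts v` (`S_log_v`) at every
`v` such that (α) `Hts v` contains `Hplus v` pushed along `𝒩⊞_v → 𝒩_v` (abc-iut-w5-d053's `pushFamily`; `hpush`) and (β) every
homotopy of `Hplus v` / `Hts v`, read inside `D_{An⊢}`, lies OVER the core `An⊢[𝒩⊢⊞]` (`hoverPlus`, `hoverTS`; Rmk 3.5.1 — NECESSARY: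
the telecore family `𝒥` contains every pair into the core vertex, so a compatible `K` forces the observable homotopies whiskered
into `An⊢` to be the lifts), there is ONE family of homotopies `K` on `D_{An⊢}` containing `𝒥` and the embedded `Hplus v`, `Hts v`:
`cor510MonoTelecoreObservablesCompatible_of`.

Construction: `K` is the family of the SINK SYSTEM (`DiagramSinkSystems`) on `D_{An⊢}` flagged at `An⊢`, `𝒩⊞_v`, `𝒩_v`
(parts 1–2: `…Shape`, `…Sinks`); its push-forward axiom (`sink_push`) is (α) along `[𝒩⊞_v → 𝒩_v]` (`sink_push_forget`), (β) into
`An⊢` (`sink_push_obs`), and vacuous otherwise by the rank function.  Then `SubFamily 𝒥 K` (`subFamily_jfam`: a telecore pair is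
a core member whiskered) and the embedded observables are contained in `K` (`compatibleInMonoTelecorePlus/TS`).  OUR kernel
constructions over a typed interface; an ASSUMPTION-discharging theorem, no claim about the genuine theaters (instance at a
genuine carrier = brick E, abc-iut-w5-d144's skeleton).  Nothing here bears on [IUTchIII] Cor. 3.12; no side taken.
-/

set_option autoImplicit false

universe u

open CategoryTheory Quiver

namespace Literature.AnabelianGeometry.AbsoluteAnabelian

namespace LogFrobeniusSetting

open DiagramOfCategories

variable {Vmod : Type u} {isArc : Vmod → Bool} (L : LogFrobeniusSetting Vmod isArc)

/-! ## Push-forward between the sinks -/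

section Push

variable (TS : L.TSHomotopies)
  (hN : ∀ v : Vmod, L.monoN v ⋙ L.toEmono v ≅ L.toE v ⋙ L.monoAn)
  (hψ : ∀ (w : Vmod) (j : {ν : LogVertex (isArc w) // ν.IsCross}),
    L.ψAnMono w j ⋙ L.forgetMono w ⋙ L.toEmono w ≅ L.κAnMono.inverse)
  (Hplus : ∀ v : Vmod, (L.logDiagramPlus v).HomotopyFamily) (Hts : ∀ v : Vmod, (L.logDiagramTS v).HomotopyFamily)
  (hpush : ∀ v : Vmod, SubFamily (pushFamily (Hplus v)) (Hts v))
  (hoverPlus : ∀ (v : Vmod) (a : (logShapePlus (isArc := isArc) v).Vertex)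
    (p q : Path a (logShapePlus (isArc := isArc) v).obs) (h : (Hplus v).E p q),
    (L.monoTeleOver hN hψ).IsOver ((embMonoPlus (monoJ (Vmod := Vmod)) v).mapPath p)
      ((embMonoPlus (monoJ (Vmod := Vmod)) v).mapPath q) (L.embPlusHom v (Hplus v) h))
  (hoverTS : ∀ (v : Vmod) (a : (logShapeTS (isArc := isArc) v).Vertex)
    (p q : Path a (logShapeTS (isArc := isArc) v).obs) (h : (Hts v).E p q),
    (L.monoTeleOver hN hψ).IsOver ((embMonoTS (monoJ (Vmod := Vmod)) v).mapPath p)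
      ((embMonoTS (monoJ (Vmod := Vmod)) v).mapPath q) (L.embTSHom v (Hts v) h))

/-- Components of a doubly `eqToHom`-conjugated natural transformation against a conjugated morphism (bookkeeping).
[folklore] -/
private theorem app_conj₂_eq_of_heq {A B : Type*} [Category A] [Category B] {F₁ F₂ F₃ G₁ G₂ G₃ : A ⥤ B}
    (a₁ : F₁ = F₂) (a₂ : F₂ = F₃) (T : F₃ ⟶ G₃) (a₃ : G₃ = G₂) (a₄ : G₂ = G₁) (X : A) {Y Z : B} (g : Y ⟶ Z)
    (b₁ : F₁.obj X = Y) (b₂ : Z = G₁.obj X) (h : HEq (T.app X) g) :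
    (eqToHom a₁ ≫ (eqToHom a₂ ≫ T ≫ eqToHom a₃) ≫ eqToHom a₄).app X = eqToHom b₁ ≫ g ≫ eqToHom b₂ := by
  subst a₁ a₂ a₃ a₄ b₁ b₂
  cases h
  simp

/-- Components against the functor of the empty path (bookkeeping). [folklore] -/
private theorem app_eq_conj_nil_map {A B : Type*} [Category A] [Category B] {F G : A ⥤ B} (θ : F ⟶ G) (x : A)
    {I : B ⥤ B} (hI : I = 𝟭 B) (h₁ : F.obj x = I.obj (F.obj x)) (h₂ : I.obj (G.obj x) = G.obj x) :
    θ.app x = eqToHom h₁ ≫ I.map (θ.app x) ≫ eqToHom h₂ := by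
  subst hI
  exact (eq_of_heq (DiagramOfCategories.HomotopyFamily.heq_eqToHom_comp_comp_eqToHom h₁ h₂ _)).symm

/-- Equal functors have heterogeneously equal actions on a morphism (bookkeeping). [folklore] -/
private theorem map_heq_of_functor_eq {A B : Type*} [Category A] [Category B] {F G : A ⥤ B} (h : F = G) {Y Z : A}
    (f : Y ⟶ Z) : HEq (F.map f) (G.map f) := by
  subst h; rfl

/-- Identities of equal objects are heterogeneously equal (bookkeeping). [folklore] -/
private theorem heq_id_of_eq {C : Type*} [Category C] {F G : C} (h : F = G) : HEq (𝟙 F) (𝟙 G) := by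
  subst h; rfl

/-- Identities of the path functors of equal diagrams are heterogeneously equal (bookkeeping). [folklore] -/
private theorem heq_id_pathFunctor {W : Type*} [Quiver W] {D₁ D₂ : DiagramOfCategories W} (h : D₁ = D₂) {a b : W}
    (p : Path a b) : HEq (𝟙 (D₁.pathFunctor p)) (𝟙 (D₂.pathFunctor p)) := by
  subst h; rfl

include hoverPlus hoverTS in
/-- **Push-forward INTO the core vertex**: a member pair of any sink post-composed with a path into `An⊢` is (trivially) a
member there, and the lift of the composite pair is the member's homotopy whiskered — because that whiskering lies over the
core (Rmk 3.5.1) and the lift is the unique such transformation. [cite: MochizukiAbsTopIII2015, Remark 3.5.1 p.78] -/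
theorem sink_push_obs {a n : (monoTeleShape Vmod isArc).Vertex} {p q : Path a n} (h : (L.sinkAt hN hψ Hplus Hts n).E p q)
    (s : Path n (monoTeleShape Vmod isArc).obs) (x : L.monoTeleDiagram.obj a) :
    ((L.sinkAt hN hψ Hplus Hts _).η (show (L.sinkAt hN hψ Hplus Hts (monoTeleShape Vmod isArc).obs).E (p.comp s) (q.comp s)
        from trivial)).app x =
      eqToHom (L.monoTeleDiagram.pathFunctor_comp_obj p s x) ≫
        (L.monoTeleDiagram.pathFunctor s).map (((L.sinkAt hN hψ Hplus Hts n).η h).app x) ≫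
          eqToHom (L.monoTeleDiagram.pathFunctor_comp_obj q s x).symm := by
  have ho := ((L.isOver_sinkη hN hψ Hplus Hts hoverPlus hoverTS h).whiskerRight s).eq_lift
    (L.monoTeleOver_ff hN hψ _ rfl)
  change ((L.monoTeleOver hN hψ).lift (L.monoTeleOver_ff hN hψ _ rfl) (p.comp s) (q.comp s)).app x = _
  rw [← ho]
  simp only [NatTrans.comp_app, eqToHom_app, Functor.whiskerRight_app]
  rfl

include hpush in
/-- **Push-forward along `𝒩⊞_v → 𝒩_v`** (the interaction of `S_log⊞_v` and `S_log_v`): a member pair of the sink at `𝒩⊞_v`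
(an embedded boundary pair of `Hplus v`) followed by `[𝒩⊞_v → 𝒩_v]` is the embedded PUSHED pair, a boundary pair of
abc-iut-w5-d053's `pushFamily (Hplus v)`, hence of `Hts v` by `hpush`, with homotopy `ζ ▹ (𝒩⊞_v → 𝒩_v)`.
[cite: MochizukiAbsTopIII2015, Cor 5.10 (iv)(b) p. 148] -/
theorem sink_push_forget (v : Vmod) {a : (monoTeleShape Vmod isArc).Vertex} (hx : monoBase (isArc := isArc) 6 (.nplus v))
    (hy : monoBase (isArc := isArc) 6 (.nv v)) {p q : Path a ((monoTeleShape Vmod isArc).base ⟨.nplus v, hx⟩)}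
    (h : (L.sinkAt hN hψ Hplus Hts _).E p q) :
    ∃ h' : (L.sinkAt hN hψ Hplus Hts _).E (p.comp (Path.nil.cons (forgetArrow v hx hy)))
        (q.comp (Path.nil.cons (forgetArrow v hx hy))),
      ∀ X : L.monoTeleDiagram.obj a, ((L.sinkAt hN hψ Hplus Hts _).η h').app X =
        eqToHom (L.monoTeleDiagram.pathFunctor_comp_obj p _ X) ≫
          (L.monoTeleDiagram.pathFunctor (Path.nil.cons (forgetArrow v hx hy))).map
              (((L.sinkAt hN hψ Hplus Hts _).η h).app X) ≫
            eqToHom (L.monoTeleDiagram.pathFunctor_comp_obj q _ X).symm := by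
  obtain ⟨w₀, hw₀⟩ := h
  have e3 : (L.sinkAt hN hψ Hplus Hts ((monoTeleShape Vmod isArc).base ⟨.nplus v, hx⟩)).η ⟨w₀, hw₀⟩ = w₀.hom :=
    liftη_eq (graphEmbedding_embMonoPlus monoJ v) _ w₀
  obtain ⟨src, left, right, mem, hs, hl, hr⟩ := w₀
  rcases src with x | _
  swap
  · exact (hw₀ rfl).elim
  subst hs; cases hl; cases hr
  have mem₀ : (Hplus v).E left right := (L.plusComap_E_iff v (Hplus v) left right).mp mem
  -- the pushed pair is a boundary pair of `pushFamily (Hplus v)`, hence of `Hts v`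
  have hpE : (pushFamily (Hplus v)).E (((plusToTS v).mapPath left).cons (forgetEdgeTS v))
      (((plusToTS v).mapPath right).cons (forgetEdgeTS v)) := ⟨PushPair.ofMem x mem₀⟩
  obtain ⟨hts, hηts⟩ := hpush v _ _ hpE
  have memT : (L.tsComap v (Hts v)).E (((plusToTS v).mapPath left).cons (forgetEdgeTS v))
      (((plusToTS v).mapPath right).cons (forgetEdgeTS v)) := (L.tsComap_E_iff v (Hts v) _ _).mpr hts
  have hpl := embMonoTS_mapPath_push v x left hx hy
  have hpr := embMonoTS_mapPath_push v x right hx hy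
  let w' : LiftPair (embMonoTS monoJ v) L.monoTeleDiagram (logShapeTS v).obs (L.tsComap v (Hts v))
      (((embMonoPlus (monoJ (Vmod := Vmod)) v).mapPath left).comp (Path.nil.cons (forgetArrow v hx hy)))
      (((embMonoPlus (monoJ (Vmod := Vmod)) v).mapPath right).comp (Path.nil.cons (forgetArrow v hx hy))) :=
    ⟨(logShapeTS v).base ⟨x.1, Or.inl x.2⟩, _, _, memT, rfl, heq_of_eq hpl, heq_of_eq hpr⟩
  refine ⟨⟨w'⟩, fun X => ?_⟩
  have e1 : (L.sinkAt hN hψ Hplus Hts ((monoTeleShape Vmod isArc).base ⟨.nv v, hy⟩)).η ⟨w'⟩ = w'.hom :=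
    liftη_eq (graphEmbedding_embMonoTS monoJ v) _ w'
  have e2 : w'.hom = eqToHom _ ≫ (eqToHom (L.monoTeleDiagram.pathFunctor_comapAlong (embMonoTS monoJ v) _).symm ≫
      (L.tsComap v (Hts v)).η memT ≫ eqToHom (L.monoTeleDiagram.pathFunctor_comapAlong (embMonoTS monoJ v) _)) ≫
        eqToHom _ :=
    L.monoTeleDiagram.transportHom_eq hpl hpr _
  refine (congrArg (fun t => NatTrans.app t X) (e1.trans e2)).trans ?_
  -- the two sides componentwise, up to the canonical identifications: `(𝒩⊞_v → 𝒩_v)` applied to the component of `ζ`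
  have hDp := L.logDiagramPlus_eq_comapAlong v
  have hDt := L.logDiagramTS_eq_comapAlong v
  have h1 : HEq (((L.tsComap v (Hts v)).η memT).app X) (((Hts v).η hts).app X) :=
    NatTrans.app_heq_of_heq rfl HEq.rfl rfl HEq.rfl (DiagramOfCategories.pathFunctor_heq_of_eq hDt _).symm
      (DiagramOfCategories.pathFunctor_heq_of_eq hDt _).symm (L.tsComap_η_heq v (Hts v) memT) HEq.rfl
  have h2 : ((Hts v).η hts).app X = ((pushFamily (Hplus v)).η hpE).app X := by rw [hηts]
  have h3 : HEq (((pushFamily (Hplus v)).η hpE).app X) ((L.forget v).map (((Hplus v).η mem₀).app X)) :=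
    pushFamily_η_app_heq (Hplus v) x mem₀ hpE X
  have hF : ∀ r : Path ((logShapePlus (isArc := isArc) v).base x) (logShapePlus (isArc := isArc) v).obs,
      (L.logDiagramPlus v).pathFunctor r = L.monoTeleDiagram.pathFunctor ((embMonoPlus (monoJ (Vmod := Vmod)) v).mapPath r) :=
    fun r => eq_of_heq ((DiagramOfCategories.pathFunctor_heq_of_eq hDp r).trans
      (heq_of_eq (L.monoTeleDiagram.pathFunctor_comapAlong (embMonoPlus monoJ v) r)))
  have h4 : HEq ((L.forget v).map (((Hplus v).η mem₀).app X))
      ((L.forget v).map ((L.embPlusHom v (Hplus v) mem₀).app X)) :=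
    map_heq_of_heq (L.forget v) (Functor.congr_obj (hF left) X) (Functor.congr_obj (hF right) X)
      (L.embPlusHom_app_heq v (Hplus v) x mem₀ X).symm
  -- `𝒟_[𝒩⊞_v → 𝒩_v]` (through the empty path) is the functor `𝒩⊞_v → 𝒩_v`
  have hcons : L.monoTeleDiagram.pathFunctor
      ((Path.nil : Path ((monoTeleShape Vmod isArc).base ⟨.nplus v, hx⟩) _).cons (forgetArrow v hx hy)) = L.forget v := by
    rw [DiagramOfCategories.pathFunctor_cons, DiagramOfCategories.pathFunctor_nil]
    exact Functor.id_comp _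
  have h5a : (L.sinkAt hN hψ Hplus Hts ((monoTeleShape Vmod isArc).base ⟨.nplus v, hx⟩)).η ⟨_, hw₀⟩ =
      L.embPlusHom v (Hplus v) mem₀ := e3
  have h5 : HEq ((L.forget v).map ((L.embPlusHom v (Hplus v) mem₀).app X))
      ((L.monoTeleDiagram.pathFunctor (Path.nil.cons (forgetArrow v hx hy))).map
        (((L.sinkAt hN hψ Hplus Hts ((monoTeleShape Vmod isArc).base ⟨.nplus v, hx⟩)).η ⟨_, hw₀⟩).app X)) :=
    (map_heq_of_functor_eq hcons.symm _).trans (heq_of_eq (congrArg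
      (fun t => (L.monoTeleDiagram.pathFunctor (Path.nil.cons (forgetArrow v hx hy))).map (NatTrans.app t X)) h5a.symm))
  exact app_conj₂_eq_of_heq _ _ _ _ _ X _ _ _ (h1.trans ((heq_of_eq h2).trans (h3.trans (h4.trans h5))))

include hpush hoverPlus hoverTS in
/-- **The push-forward axiom** for the sinks of `D_{An⊢}`: into the core vertex by `sink_push_obs`; along `[𝒩⊞_v → 𝒩_v]` by
`sink_push_forget`; all other paths between flagged vertices are trivial or absent (the rank increases).
[cite: MochizukiAbsTopIII2015, Cor 5.10 (iv)(b) p. 148] -/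
theorem sink_push {a n n' : (monoTeleShape Vmod isArc).Vertex} {p q : Path a n} (h : (L.sinkAt hN hψ Hplus Hts n).E p q)
    (s : Path n n') (hn' : isObsMono n' = true) :
    ∃ h' : (L.sinkAt hN hψ Hplus Hts n').E (p.comp s) (q.comp s), ∀ x : L.monoTeleDiagram.obj a,
      ((L.sinkAt hN hψ Hplus Hts n').η h').app x = eqToHom (L.monoTeleDiagram.pathFunctor_comp_obj p s x) ≫
        (L.monoTeleDiagram.pathFunctor s).map (((L.sinkAt hN hψ Hplus Hts n).η h).app x) ≫
          eqToHom (L.monoTeleDiagram.pathFunctor_comp_obj q s x).symm := by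
  rcases n' with ⟨⟨k⟩ | _ | ⟨w⟩ | ⟨w⟩ | _ | _ | _ | ⟨w⟩ | ⟨w⟩ | _ | _ | _, hy⟩ | _
  · simp [isObsMono] at hn'
  · simp [isObsMono] at hn'
  · -- into `𝒩⊞_w`: only the trivial path, from `𝒩⊞_w` itself
    rcases n with ⟨⟨k'⟩ | _ | ⟨v⟩ | ⟨v⟩ | _ | _ | _ | ⟨v⟩ | ⟨v⟩ | _ | _ | _, hx⟩ | _
    · exact (h : False).elim
    · exact (h : False).elim
    · have hl := length_eq_zero_of_rank s (le_of_eq ((rank_base_nplus w hy).trans (rank_base_nplus v hx).symm))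
        (le_of_eq (rank_base_nplus v hx).symm) ((rank_base_nplus v hx).trans_le one_le_two)
      cases s with
      | cons s e => exact absurd hl (Nat.succ_ne_zero _)
      | nil =>
        exact ⟨h, fun x => app_eq_conj_nil_map _ x (L.monoTeleDiagram.pathFunctor_nil _) _ _⟩
    · exact absurd ((rank_base_nv v hx).symm.trans_le ((rank_le_of_path s).trans_eq (rank_base_nplus w hy)))
        (Nat.not_succ_le_self 1)
    · exact (h : False).elim
    · exact (h : False).elim
    · exact (h : False).elim
    · exact (h : False).elim
    · exact (h : False).elim
    · exact (h : False).elim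
    · exact (h : False).elim
    · exact (h : False).elim
    · exact (false_of_path_obs s ((rank_base_nplus w hy).trans_le one_le_two)).elim
  · -- into `𝒩_w`: the trivial path from `𝒩_w`, or `[𝒩⊞_w → 𝒩_w]` from `𝒩⊞_w`
    rcases n with ⟨⟨k'⟩ | _ | ⟨v⟩ | ⟨v⟩ | _ | _ | _ | ⟨v⟩ | ⟨v⟩ | _ | _ | _, hx⟩ | _
    · exact (h : False).elim
    · exact (h : False).elim
    · -- from `𝒩⊞_v`
      cases s with
      | cons s₀ e =>
        rename_i c
        rcases c with ⟨⟨z, hz⟩⟩ | _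
        · change DEdge isArc z (.nv w) at e
          cases e with
          | forget _ =>
            have hl := length_eq_zero_of_rank s₀
              (le_of_eq ((rank_base_nplus w hz).trans (rank_base_nplus v hx).symm))
              (le_of_eq (rank_base_nplus v hx).symm) ((rank_base_nplus v hx).trans_le one_le_two)
            cases s₀ with
            | cons _ _ => exact absurd hl (Nat.succ_ne_zero _)
            | nil => exact L.sink_push_forget hN hψ Hplus Hts hpush w hx hy h
        · exact PEmpty.elim e
    · -- from `𝒩_v`
      have hl := length_eq_zero_of_rank s (le_of_eq ((rank_base_nv w hy).trans (rank_base_nv v hx).symm))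
        (one_le_two.trans_eq (rank_base_nv v hx).symm) (le_of_eq (rank_base_nv v hx))
      cases s with
      | cons s e => exact absurd hl (Nat.succ_ne_zero _)
      | nil =>
        exact ⟨h, fun x => app_eq_conj_nil_map _ x (L.monoTeleDiagram.pathFunctor_nil _) _ _⟩
    · exact (h : False).elim
    · exact (h : False).elim
    · exact (h : False).elim
    · exact (h : False).elim
    · exact (h : False).elim
    · exact (h : False).elim
    · exact (h : False).elim
    · exact (h : False).elim
    · exact (false_of_path_obs s (le_of_eq (rank_base_nv w hy))).elim
  · simp [isObsMono] at hn'
  · simp [isObsMono] at hn'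
  · simp [isObsMono] at hn'
  · simp [isObsMono] at hn'
  · simp [isObsMono] at hn'
  · simp [isObsMono] at hn'
  · simp [isObsMono] at hn'
  · simp [isObsMono] at hn'
  · exact ⟨trivial, fun x => L.sink_push_obs hN hψ Hplus Hts hoverPlus hoverTS h s x⟩

/-! ## The sink system, its family `K`, and Cor 5.10 (iv)(b) last sentence -/

/-- **The sink system of `D_{An⊢}`** (core lifts at `An⊢`, `S_log⊞_v` at `𝒩⊞_v`, `S_log_v` at `𝒩_v`).
[cite: MochizukiAbsTopIII2015, Cor 5.10 (iv)(b) p. 148] -/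
noncomputable def sinkSystem : SinkSystem L.monoTeleDiagram isObsMono where
  E := fun _ n p q => (L.sinkAt hN hψ Hplus Hts n).E p q
  mem_isObs := fun _ _ _ _ h => L.isObsMono_of_mem hN hψ Hplus Hts h
  η := fun _ n _ _ h => (L.sinkAt hN hψ Hplus Hts n).η h
  η_self := fun _ _ _ h => L.sink_η_self hN hψ Hplus Hts h
  trans := fun _ _ _ _ _ h₁ h₂ => L.sink_trans hN hψ Hplus Hts h₁ h₂
  precomp := fun _ _ _ _ _ h r => L.sink_precomp hN hψ Hplus Hts h r
  push := fun _ _ _ _ _ h s hn' => L.sink_push hN hψ Hplus Hts hpush hoverPlus hoverTS h s hn'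

/-- **The family `K` on `D_{An⊢}`** generated by the sink system (`DiagramSinkSystems`).
[cite: MochizukiAbsTopIII2015, Cor 5.10 (iv)(b) p. 148] -/
noncomputable def obsFamily : L.monoTeleDiagram.HomotopyFamily :=
  (L.sinkSystem hN hψ Hplus Hts hpush hoverPlus hoverTS).family

include hpush hoverPlus hoverTS in
/-- **`K` contains the telecore family `𝒥` of `𝔗_{An⊢}`** (Def 3.5 (iv)(b): a telecore pair `([γ₃]∘[γ₁], [γ₃]∘[γ₂])` is the
member `(γ₁, γ₂)` of the sink at `An⊢` whiskered by `γ₃`; both families give abc-iut-L4-t5's lift whiskered).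
[cite: MochizukiAbsTopIII2015, Cor 5.10 (iv)(b) p. 148] -/
theorem subFamily_jfam [Nonempty Vmod] :
    SubFamily (L.monoTelecore hN hψ).Jfam (L.obsFamily hN hψ Hplus Hts hpush hoverPlus hoverTS) := by
  intro a b P Q h
  obtain ⟨⟨w, hw, p₁, q₁, s, hP, hQ⟩⟩ := h
  subst hw
  obtain ⟨h', e⟩ := (L.sinkSystem hN hψ Hplus Hts hpush hoverPlus hoverTS).family_η_tail
    (show (L.sinkSystem hN hψ Hplus Hts hpush hoverPlus hoverTS).E p₁ q₁ from trivial) s hP hQ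
  refine ⟨h', ?_⟩
  change (univFamily (L.monoTeleOver hN hψ) (· = (monoTeleShape Vmod isArc).obs) (L.monoTeleOver_ff hN hψ)).η _ =
    (L.sinkSystem hN hψ Hplus Hts hpush hoverPlus hoverTS).family.η h'
  rw [e]
  exact univFamily_η_eq (L.monoTeleOver hN hψ) (· = (monoTeleShape Vmod isArc).obs) (L.monoTeleOver_ff hN hψ) _
    ⟨(monoTeleShape Vmod isArc).obs, rfl, p₁, q₁, s, hP, hQ⟩

include hpush hoverPlus hoverTS in
/-- **`K` contains the embedded `S_log⊞_v`** (a boundary pair of `Hplus v` with source in `D•_{≤2}` is a member of the sink at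
`𝒩⊞_v`; the diagonal pair at `𝒩⊞_v` is the identity on both sides). [cite: MochizukiAbsTopIII2015, Cor 5.10 (iv)(b) p. 148] -/
theorem compatibleInMonoTelecorePlus [Nonempty Vmod] (v : Vmod) (hobs : L.IsLogObservablePlus v (Hplus v)) :
    L.CompatibleInMonoTelecorePlus (L.monoTelecore hN hψ).J (L.monoTelecore hN hψ).telMap
      (L.obsFamily hN hψ Hplus Hts hpush hoverPlus hoverTS) v (Hplus v) := by
  intro a b p q h
  obtain rfl : b = (logShapePlus (isArc := isArc) v).obs := hobs.1 h
  rcases a with x | _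
  · have mem : (L.plusComap v (Hplus v)).E p q := (L.plusComap_E_iff v (Hplus v) p q).mpr h
    have hE : (L.sinkSystem hN hψ Hplus Hts hpush hoverPlus hoverTS).E ((embMonoPlus (monoJ (Vmod := Vmod)) v).mapPath p)
        ((embMonoPlus (monoJ (Vmod := Vmod)) v).mapPath q) := ⟨LiftPair.ofMem mem, fun h => by cases h⟩
    obtain ⟨h', e⟩ := (L.sinkSystem hN hψ Hplus Hts hpush hoverPlus hoverTS).family_η_of_mem hE
    have e2 : (L.sinkSystem hN hψ Hplus Hts hpush hoverPlus hoverTS).η hE = L.embPlusHom v (Hplus v) h :=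
      liftη_eq (graphEmbedding_embMonoPlus monoJ v) _ (LiftPair.ofMem mem)
    refine ⟨h', ?_⟩
    change HEq _ ((L.sinkSystem hN hψ Hplus Hts hpush hoverPlus hoverTS).family.η h')
    rw [e, e2, embPlusHom, LiftPair.hom_ofMem]
    exact ((DiagramOfCategories.HomotopyFamily.heq_eqToHom_comp_comp_eqToHom _ _ _).trans
      (L.plusComap_η_heq v (Hplus v) _)).symm
  · have hout := ExtShape.isEmpty_hom_obs (logShapePlus (isArc := isArc) v)
      (fun _ => (inferInstance : IsEmpty PEmpty.{u + 1}))
    obtain rfl := path_eq_nil_of_isEmpty_hom hout p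
    obtain rfl := path_eq_nil_of_isEmpty_hom hout q
    refine ⟨⟨Chain₂.nil _⟩, ?_⟩
    rw [(Hplus v).η_refl h, (L.obsFamily hN hψ Hplus Hts hpush hoverPlus hoverTS).η_refl]
    exact (heq_id_pathFunctor (L.logDiagramPlus_eq_comapAlong v) _).trans
      (heq_id_of_eq (L.monoTeleDiagram.pathFunctor_comapAlong (embMonoPlus monoJ v) _))

include hpush hoverPlus hoverTS in
/-- **`K` contains the embedded `S_log_v`**. [cite: MochizukiAbsTopIII2015, Cor 5.10 (iv)(b) p. 148] -/
theorem compatibleInMonoTelecoreTS [Nonempty Vmod] (v : Vmod) (hobs : L.IsLogObservableTS TS v (Hts v)) :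
    L.CompatibleInMonoTelecoreTS (L.monoTelecore hN hψ).J (L.monoTelecore hN hψ).telMap
      (L.obsFamily hN hψ Hplus Hts hpush hoverPlus hoverTS) v (Hts v) := by
  intro a b p q h
  obtain rfl : b = (logShapeTS (isArc := isArc) v).obs := hobs.1 h
  have mem : (L.tsComap v (Hts v)).E p q := (L.tsComap_E_iff v (Hts v) p q).mpr h
  have hE : (L.sinkSystem hN hψ Hplus Hts hpush hoverPlus hoverTS).E ((embMonoTS (monoJ (Vmod := Vmod)) v).mapPath p)
      ((embMonoTS (monoJ (Vmod := Vmod)) v).mapPath q) := ⟨LiftPair.ofMem mem⟩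
  obtain ⟨h', e⟩ := (L.sinkSystem hN hψ Hplus Hts hpush hoverPlus hoverTS).family_η_of_mem hE
  have e2 : (L.sinkSystem hN hψ Hplus Hts hpush hoverPlus hoverTS).η hE = L.embTSHom v (Hts v) h :=
    liftη_eq (graphEmbedding_embMonoTS monoJ v) _ (LiftPair.ofMem mem)
  refine ⟨h', ?_⟩
  change HEq _ ((L.sinkSystem hN hψ Hplus Hts hpush hoverPlus hoverTS).family.η h')
  rw [e, e2, embTSHom, LiftPair.hom_ofMem]
  exact ((DiagramOfCategories.HomotopyFamily.heq_eqToHom_comp_comp_eqToHom _ _ _).trans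
    (L.tsComap_η_heq v (Hts v) _)).symm

include hpush hoverPlus hoverTS in
/-- ★ **[AbsTopIII] Cor 5.10 (iv)(b), last sentence — SUFFICIENCY** (abc-iut-w5-d144's `Cor510MonoTelecoreObservablesCompatible`,
`s_b′`): for a setting with `V(F_mod) ≠ ∅` carrying the rows-4→5 mono-analyticization homotopies `hN` and "`ψ^{An⊢⊞}` over
`ℰ⊢`" `hψ`, and observables `S_log⊞_v = Hplus v`, `S_log_v = Hts v` at every `v` such that `Hts v` contains `Hplus v` pushed along
`𝒩⊞_v → 𝒩_v` (`hpush`) and all their homotopies, read in `D_{An⊢}`, lie over the core `An⊢[𝒩⊢⊞]` (`hoverPlus`, `hoverTS`), the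
telecore `𝔗_{An⊢}` (this seat's `monoTelecore`) and the observables are COMPATIBLE: one family `K` on `D_{An⊢}` contains `𝒥` and
all the embedded `S_log⊞_v`, `S_log_v`. [cite: MochizukiAbsTopIII2015, Cor 5.10 (iv)(b) pp. 147–148] -/
theorem cor510MonoTelecoreObservablesCompatible_of [Nonempty Vmod]
    (hobs : ∀ v : Vmod, L.IsLogObservablePlus v (Hplus v) ∧ L.IsLogObservableTS TS v (Hts v)) :
    L.Cor510MonoTelecoreObservablesCompatible TS := by
  refine ⟨_, _, L.monoCoreObs_isCore hN, L.monoTelecore hN hψ, rfl, HEq.rfl, Hplus, Hts,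
    L.obsFamily hN hψ Hplus Hts hpush hoverPlus hoverTS, hobs, L.subFamily_jfam hN hψ Hplus Hts hpush hoverPlus hoverTS,
    fun v => ⟨?_, ?_⟩⟩
  · exact L.compatibleInMonoTelecorePlus hN hψ Hplus Hts hpush hoverPlus hoverTS v (hobs v).1
  · exact L.compatibleInMonoTelecoreTS TS hN hψ Hplus Hts hpush hoverPlus hoverTS v (hobs v).2

end Push

end LogFrobeniusSetting

end Literature.AnabelianGeometry.AbsoluteAnabelian
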